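import Summits.RiemannHypothesis.RiemannHypothesis.Theses.SpectralTrace
import Summits.RiemannHypothesis.RiemannHypothesis.Theorems.SpectralTraceWindowCompactness
import Summits.RiemannHypothesis.RiemannHypothesis.Theorems.SpectralTraceSpectralThesisStubClosedLadder
import HarnessLib

/-!
# SpectralTrace / crux `SpectralThesis` (stmt-RiemannHypothesis-0187), line `Sketch` —
calibration of the openness stub: given the seed, `OpenLadder ↔ RH`

The line `Sketch` (lead skeleton `Cruxes/SpectralThesis/Lines/Sketch.lean`) writes the crux
`X = SpectralThesis` as a continuity method on the window parameter: with the OPEN-WINDOW rungs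

  `Rung(A) := ∃ (ι : Type) (γ : ι → ℝ), ∀ g, IsWeilTest g → tsupport g ⊆ Ioo (-A) A →
      HasSum (i ↦ ĝ(1/2 + iγ_i)) (W g)`,

BASE (`∃ A₀ > 0, Rung(A₀)`) + OPEN (`∀ A > 0, Rung(A) → ∃ ε > 0, Rung(A + ε)`) + CLOSED
(`∀ A > 0, (∀ A' ∈ (0, A), Rung(A')) → Rung(A)`) give every rung, hence the ladder, hence `X`.
CLOSED is a theorem (`stub_closedLadder`, cell-wise ultrafilter limit of witnesses, landed in
`Theorems/SpectralTraceSpectralThesisStubClosedLadder.lean`). This file is the honest calibration of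
the remaining two stubs (all sorry-free):

* `forall_pos_of_continuity` — the order-theoretic continuity method on `(0, ∞)`;
* `forall_rung_of_base_of_open` — BASE + OPEN ⇒ every rung (closedness supplied by the theorem);
* `spectralThesis_of_base_of_open`, `riemannHypothesis_of_base_of_open` — hence `X` and RH;
* `open_of_riemannHypothesis`, `base_of_riemannHypothesis` — RH gives both stubs back;
* `spectralThesis_iff_base_and_open : X ↔ BASE ∧ OPEN`, `spectralThesis_iff_forall_rung`;
* `base_of_windowTraceArch` — the route's seed item `WindowTraceArch` (stmt-RiemannHypothesis-11195)
  gives BASE, so **`stub_openLadder_calibration : WindowTraceArch → (OPEN ↔ RiemannHypothesis)`**: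
  in this line the Riemann hypothesis sits exactly in the openness stub.

References: E. Bombieri, Rend. Lincei (9) 11 (2000) 183–233, Thms. 1–2 (Weil's criterion, explicit
formula; in-tree `riemannHypothesis_of_ladder`, `spectralThesis_of_riemannHypothesis`).
-/

noncomputable section

set_option linter.dupNamespace false

namespace Summit.RiemannHypothesis.RiemannHypothesis.Theorems.SpectralThesis.Sketch

open Complex Set
open Literature.NumberTheory.LFunctions
open Summit.RiemannHypothesis.RiemannHypothesis.Theses.SpectralTrace
open Summit.RiemannHypothesis.RiemannHypothesis.Theorems

/-! ## The continuity method on `(0, ∞)` -/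

/-- **Continuity method on a real parameter.** A down-closed property of positive reals which
holds at some positive point, extends a little beyond every positive point where it holds, and
passes to increasing limits, holds at every positive real (the good set is a non-empty, open and
closed down-set of `(0, ∞)`: argue at its supremum). [folklore] -/
theorem forall_pos_of_continuity {P : ℝ → Prop} (mono : ∀ {x y : ℝ}, x ≤ y → P y → P x)
    (base : ∃ A₀ : ℝ, 0 < A₀ ∧ P A₀) (opn : ∀ A : ℝ, 0 < A → P A → ∃ ε : ℝ, 0 < ε ∧ P (A + ε))
    (cls : ∀ A : ℝ, 0 < A → (∀ A' : ℝ, 0 < A' → A' < A → P A') → P A) :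
    ∀ A : ℝ, 0 < A → P A := by
  intro A hA
  by_contra hnot
  obtain ⟨A₀, hA₀, hP₀⟩ := base
  set S : Set ℝ := {x | 0 < x ∧ P x} with hS
  have hmem₀ : A₀ ∈ S := ⟨hA₀, hP₀⟩
  have hne : S.Nonempty := ⟨A₀, hmem₀⟩
  have hbdd : ∀ x ∈ S, x ≤ A := by
    intro x hx
    by_contra hxA
    push Not at hxA
    exact hnot (mono hxA.le hx.2)
  have hBdd : BddAbove S := ⟨A, hbdd⟩
  have hs_pos : 0 < sSup S := lt_of_lt_of_le hA₀ (le_csSup hBdd hmem₀)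
  have hPs : P (sSup S) := by
    refine cls (sSup S) hs_pos ?_
    intro A' _ hA'lt
    obtain ⟨x, hxS, hA'x⟩ := exists_lt_of_lt_csSup hne hA'lt
    exact mono hA'x.le hxS.2
  obtain ⟨ε, hε, hPε⟩ := opn (sSup S) hs_pos hPs
  have hle : sSup S + ε ≤ sSup S := le_csSup hBdd ⟨by linarith, hPε⟩
  linarith

/-! ## Open-window rungs: monotonicity and the closed-window ladder -/

/-- Open-window rungs are monotone in the window: a witness for `(-A', A')` serves `(-A, A)` for
`A ≤ A'`. [folklore] -/
theorem rung_mono {A A' : ℝ} (h : A ≤ A')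
    (hA' : ∃ (ι : Type) (γ : ι → ℝ), ∀ g : ℝ → ℂ, IsWeilTest g → tsupport g ⊆ Set.Ioo (-A') A' →
      HasSum (fun i => weilMellin g (1 / 2 + (γ i : ℂ) * I)) (weilFunctional g)) :
    ∃ (ι : Type) (γ : ι → ℝ), ∀ g : ℝ → ℂ, IsWeilTest g → tsupport g ⊆ Set.Ioo (-A) A →
      HasSum (fun i => weilMellin g (1 / 2 + (γ i : ℂ) * I)) (weilFunctional g) := by
  obtain ⟨ι, γ, hγ⟩ := hA'
  exact ⟨ι, γ, fun g hg hgs => hγ g hg (hgs.trans (Ioo_subset_Ioo (by linarith) h))⟩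

/-- Open-window rungs at every `A > 0` give the route's closed-window ladder
`∀ A > 0, ∃ ι γ, ∀ g, IsWeilTest g → tsupport g ⊆ Icc (-A) A → HasSum …` (use the rung at
`A + 1`). [folklore] -/
theorem ladder_of_forall_rung
    (h : ∀ A : ℝ, 0 < A → ∃ (ι : Type) (γ : ι → ℝ), ∀ g : ℝ → ℂ, IsWeilTest g →
      tsupport g ⊆ Set.Ioo (-A) A →
        HasSum (fun i => weilMellin g (1 / 2 + (γ i : ℂ) * I)) (weilFunctional g)) :
    ∀ A : ℝ, 0 < A → ∃ (ι : Type) (γ : ι → ℝ), ∀ g : ℝ → ℂ, IsWeilTest g →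
      tsupport g ⊆ Set.Icc (-A) A →
        HasSum (fun i => weilMellin g (1 / 2 + (γ i : ℂ) * I)) (weilFunctional g) := by
  intro A hA
  obtain ⟨ι, γ, hγ⟩ := h (A + 1) (by linarith)
  exact ⟨ι, γ, fun g hg hgs => hγ g hg (hgs.trans (Icc_subset_Ioo (by linarith) (by linarith)))⟩

/-! ## `X`, RH and the open-window rungs -/

/-- **Every open window carries a rung ⇒ RH** (closed ladder at `A + 1`, then the Bochner form and
Yoshida's form of Weil's criterion, `riemannHypothesis_of_ladder`). [Bombieri2000Weil, Thms. 1–2] -/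
theorem riemannHypothesis_of_forall_rung
    (h : ∀ A : ℝ, 0 < A → ∃ (ι : Type) (γ : ι → ℝ), ∀ g : ℝ → ℂ, IsWeilTest g →
      tsupport g ⊆ Set.Ioo (-A) A →
        HasSum (fun i => weilMellin g (1 / 2 + (γ i : ℂ) * I)) (weilFunctional g)) :
    _root_.RiemannHypothesis :=
  riemannHypothesis_of_ladder (ladder_of_forall_rung h)

/-- **RH ⇒ every open window carries a rung** (restrict the global witness of
`spectralThesis_of_riemannHypothesis`: the zero ordinates with multiplicity).
[Bombieri2000Weil, Thm. 2 (explicit formula)] -/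
theorem forall_rung_of_riemannHypothesis (h : _root_.RiemannHypothesis) :
    ∀ A : ℝ, 0 < A → ∃ (ι : Type) (γ : ι → ℝ), ∀ g : ℝ → ℂ, IsWeilTest g →
      tsupport g ⊆ Set.Ioo (-A) A →
        HasSum (fun i => weilMellin g (1 / 2 + (γ i : ℂ) * I)) (weilFunctional g) := by
  obtain ⟨ι, γ, hγ⟩ := spectralThesis_of_riemannHypothesis h
  exact fun A _ => ⟨ι, γ, fun g hg _ => hγ g hg⟩

/-- **`X ↔` every open window carries a rung.** [folklore] -/
theorem spectralThesis_iff_forall_rung :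
    SpectralThesis ↔ ∀ A : ℝ, 0 < A → ∃ (ι : Type) (γ : ι → ℝ), ∀ g : ℝ → ℂ, IsWeilTest g →
      tsupport g ⊆ Set.Ioo (-A) A →
        HasSum (fun i => weilMellin g (1 / 2 + (γ i : ℂ) * I)) (weilFunctional g) := by
  refine ⟨fun ⟨ι, γ, hγ⟩ A _ => ⟨ι, γ, fun g hg _ => hγ g hg⟩, fun h => ?_⟩
  exact spectralThesis_of_riemannHypothesis (riemannHypothesis_of_forall_rung h)

/-! ## BASE + OPEN ⇒ every rung (closedness is the theorem `stub_closedLadder`) -/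

/-- **The continuity method for the window ladder, with closedness discharged.** If some positive
open window carries a rung (BASE) and every rung extends a little (OPEN), then every open window
carries a rung — closedness under increasing limits is the landed theorem `stub_closedLadder`
(cell-wise ultrafilter limit of witnesses). [folklore] -/
theorem forall_rung_of_base_of_open
    (hB : ∃ A₀ : ℝ, 0 < A₀ ∧ ∃ (ι : Type) (γ : ι → ℝ), ∀ g : ℝ → ℂ, IsWeilTest g →
      tsupport g ⊆ Set.Ioo (-A₀) A₀ →
        HasSum (fun i => weilMellin g (1 / 2 + (γ i : ℂ) * I)) (weilFunctional g))
    (hO : ∀ A : ℝ, 0 < A →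
      (∃ (ι : Type) (γ : ι → ℝ), ∀ g : ℝ → ℂ, IsWeilTest g → tsupport g ⊆ Set.Ioo (-A) A →
        HasSum (fun i => weilMellin g (1 / 2 + (γ i : ℂ) * I)) (weilFunctional g)) →
      ∃ ε : ℝ, 0 < ε ∧ ∃ (ι : Type) (γ : ι → ℝ), ∀ g : ℝ → ℂ, IsWeilTest g →
        tsupport g ⊆ Set.Ioo (-(A + ε)) (A + ε) →
          HasSum (fun i => weilMellin g (1 / 2 + (γ i : ℂ) * I)) (weilFunctional g)) :
    ∀ A : ℝ, 0 < A → ∃ (ι : Type) (γ : ι → ℝ), ∀ g : ℝ → ℂ, IsWeilTest g →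
      tsupport g ⊆ Set.Ioo (-A) A →
        HasSum (fun i => weilMellin g (1 / 2 + (γ i : ℂ) * I)) (weilFunctional g) :=
  forall_pos_of_continuity
    (P := fun A => ∃ (ι : Type) (γ : ι → ℝ), ∀ g : ℝ → ℂ, IsWeilTest g →
      tsupport g ⊆ Set.Ioo (-A) A →
        HasSum (fun i => weilMellin g (1 / 2 + (γ i : ℂ) * I)) (weilFunctional g))
    (fun hxy hy => rung_mono hxy hy) hB hO stub_closedLadder

/-- **BASE + OPEN ⇒ `X`.** [folklore] -/
theorem spectralThesis_of_base_of_open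
    (hB : ∃ A₀ : ℝ, 0 < A₀ ∧ ∃ (ι : Type) (γ : ι → ℝ), ∀ g : ℝ → ℂ, IsWeilTest g →
      tsupport g ⊆ Set.Ioo (-A₀) A₀ →
        HasSum (fun i => weilMellin g (1 / 2 + (γ i : ℂ) * I)) (weilFunctional g))
    (hO : ∀ A : ℝ, 0 < A →
      (∃ (ι : Type) (γ : ι → ℝ), ∀ g : ℝ → ℂ, IsWeilTest g → tsupport g ⊆ Set.Ioo (-A) A →
        HasSum (fun i => weilMellin g (1 / 2 + (γ i : ℂ) * I)) (weilFunctional g)) →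
      ∃ ε : ℝ, 0 < ε ∧ ∃ (ι : Type) (γ : ι → ℝ), ∀ g : ℝ → ℂ, IsWeilTest g →
        tsupport g ⊆ Set.Ioo (-(A + ε)) (A + ε) →
          HasSum (fun i => weilMellin g (1 / 2 + (γ i : ℂ) * I)) (weilFunctional g)) :
    SpectralThesis :=
  spectralThesis_iff_forall_rung.2 (forall_rung_of_base_of_open hB hO)

/-- **BASE + OPEN ⇒ RH.** [folklore] -/
theorem riemannHypothesis_of_base_of_open
    (hB : ∃ A₀ : ℝ, 0 < A₀ ∧ ∃ (ι : Type) (γ : ι → ℝ), ∀ g : ℝ → ℂ, IsWeilTest g →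
      tsupport g ⊆ Set.Ioo (-A₀) A₀ →
        HasSum (fun i => weilMellin g (1 / 2 + (γ i : ℂ) * I)) (weilFunctional g))
    (hO : ∀ A : ℝ, 0 < A →
      (∃ (ι : Type) (γ : ι → ℝ), ∀ g : ℝ → ℂ, IsWeilTest g → tsupport g ⊆ Set.Ioo (-A) A →
        HasSum (fun i => weilMellin g (1 / 2 + (γ i : ℂ) * I)) (weilFunctional g)) →
      ∃ ε : ℝ, 0 < ε ∧ ∃ (ι : Type) (γ : ι → ℝ), ∀ g : ℝ → ℂ, IsWeilTest g →
        tsupport g ⊆ Set.Ioo (-(A + ε)) (A + ε) →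
          HasSum (fun i => weilMellin g (1 / 2 + (γ i : ℂ) * I)) (weilFunctional g)) :
    _root_.RiemannHypothesis :=
  riemannHypothesis_of_forall_rung (forall_rung_of_base_of_open hB hO)

/-- **RH ⇒ OPEN** (every rung holds under RH, so every rung extends, by `1`). [folklore] -/
theorem open_of_riemannHypothesis (h : _root_.RiemannHypothesis) :
    ∀ A : ℝ, 0 < A →
      (∃ (ι : Type) (γ : ι → ℝ), ∀ g : ℝ → ℂ, IsWeilTest g → tsupport g ⊆ Set.Ioo (-A) A →
        HasSum (fun i => weilMellin g (1 / 2 + (γ i : ℂ) * I)) (weilFunctional g)) →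
      ∃ ε : ℝ, 0 < ε ∧ ∃ (ι : Type) (γ : ι → ℝ), ∀ g : ℝ → ℂ, IsWeilTest g →
        tsupport g ⊆ Set.Ioo (-(A + ε)) (A + ε) →
          HasSum (fun i => weilMellin g (1 / 2 + (γ i : ℂ) * I)) (weilFunctional g) :=
  fun A hA _ => ⟨1, one_pos, forall_rung_of_riemannHypothesis h (A + 1) (by linarith)⟩

/-- **RH ⇒ BASE** (the rung at `A₀ = 1`). [folklore] -/
theorem base_of_riemannHypothesis (h : _root_.RiemannHypothesis) :
    ∃ A₀ : ℝ, 0 < A₀ ∧ ∃ (ι : Type) (γ : ι → ℝ), ∀ g : ℝ → ℂ, IsWeilTest g →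
      tsupport g ⊆ Set.Ioo (-A₀) A₀ →
        HasSum (fun i => weilMellin g (1 / 2 + (γ i : ℂ) * I)) (weilFunctional g) :=
  ⟨1, one_pos, forall_rung_of_riemannHypothesis h 1 one_pos⟩

/-- **`X ↔ BASE ∧ OPEN`**: with closedness a theorem, the line's split of the crux loses nothing
and needs nothing else. [folklore] -/
theorem spectralThesis_iff_base_and_open :
    SpectralThesis ↔
      ((∃ A₀ : ℝ, 0 < A₀ ∧ ∃ (ι : Type) (γ : ι → ℝ), ∀ g : ℝ → ℂ, IsWeilTest g →
        tsupport g ⊆ Set.Ioo (-A₀) A₀ →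
          HasSum (fun i => weilMellin g (1 / 2 + (γ i : ℂ) * I)) (weilFunctional g)) ∧
      (∀ A : ℝ, 0 < A →
        (∃ (ι : Type) (γ : ι → ℝ), ∀ g : ℝ → ℂ, IsWeilTest g → tsupport g ⊆ Set.Ioo (-A) A →
          HasSum (fun i => weilMellin g (1 / 2 + (γ i : ℂ) * I)) (weilFunctional g)) →
        ∃ ε : ℝ, 0 < ε ∧ ∃ (ι : Type) (γ : ι → ℝ), ∀ g : ℝ → ℂ, IsWeilTest g →
          tsupport g ⊆ Set.Ioo (-(A + ε)) (A + ε) →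
            HasSum (fun i => weilMellin g (1 / 2 + (γ i : ℂ) * I)) (weilFunctional g))) := by
  refine ⟨fun h => ?_, fun ⟨hB, hO⟩ => spectralThesis_of_base_of_open hB hO⟩
  have hRH : _root_.RiemannHypothesis :=
    riemannHypothesis_of_forall_rung (spectralThesis_iff_forall_rung.1 h)
  exact ⟨base_of_riemannHypothesis hRH, open_of_riemannHypothesis hRH⟩

/-! ## The seed item gives the base; hence OPEN ↔ RH given the seed -/

/-- The route's seed item `WindowTraceArch` (stmt-RiemannHypothesis-11195: a rung on the closed
window `[-log 2, log 2]`) gives BASE with `A₀ = log 2`. [folklore] -/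
theorem base_of_windowTraceArch (h : WindowTraceArch) :
    ∃ A₀ : ℝ, 0 < A₀ ∧ ∃ (ι : Type) (γ : ι → ℝ), ∀ g : ℝ → ℂ, IsWeilTest g →
      tsupport g ⊆ Set.Ioo (-A₀) A₀ →
        HasSum (fun i => weilMellin g (1 / 2 + (γ i : ℂ) * I)) (weilFunctional g) := by
  obtain ⟨ι, γ, hγ⟩ := h
  exact ⟨Real.log 2, Real.log_pos one_lt_two, ι, γ,
    fun g hg hgs => hγ g hg (hgs.trans Ioo_subset_Icc_self)⟩

/-- **Calibration of the openness stub (registered anchor `stub_openLadder_calibration`).** Given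
the route's seed `WindowTraceArch` (stmt-RiemannHypothesis-11195), the openness stub of line
`Sketch` — every open-window rung extends to a slightly larger window — is EQUIVALENT to the
Riemann hypothesis: `→` by the continuity method with the landed closedness
(`riemannHypothesis_of_base_of_open`), `←` because under RH every rung holds
(`open_of_riemannHypothesis`). So in this line RH sits exactly in `stub_openLadder`. [folklore] -/
theorem stub_openLadder_calibration :
    Summit.RiemannHypothesis.RiemannHypothesis.Theses.SpectralTrace.WindowTraceArch →
      ((∀ A : ℝ, 0 < A →
        (∃ (ι : Type) (γ : ι → ℝ), ∀ g : ℝ → ℂ, IsWeilTest g → tsupport g ⊆ Set.Ioo (-A) A →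
          HasSum (fun i => weilMellin g (1 / 2 + (γ i : ℂ) * I)) (weilFunctional g)) →
        ∃ ε : ℝ, 0 < ε ∧ ∃ (ι : Type) (γ : ι → ℝ), ∀ g : ℝ → ℂ, IsWeilTest g →
          tsupport g ⊆ Set.Ioo (-(A + ε)) (A + ε) →
            HasSum (fun i => weilMellin g (1 / 2 + (γ i : ℂ) * I)) (weilFunctional g)) ↔
      RiemannHypothesis) :=
  fun hArch => ⟨fun hO => riemannHypothesis_of_base_of_open (base_of_windowTraceArch hArch) hO,
    open_of_riemannHypothesis⟩

end Summit.RiemannHypothesis.RiemannHypothesis.Theorems.SpectralThesis.Sketch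

end
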